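import Literature.Probability.Percolation.CriticalContinuity
import Literature.Barriers.CriticalPhenomena.TransverseCrossingsNeedNotMeetNarrow
import Literature.Probability.Percolation.SharpnessDCTProofs
import Literature.Probability.Percolation.InequalitiesProofs
import Literature.Probability.Percolation.CornerPercolation
import Literature.Probability.Percolation.RSW
import HarnessLib

/-!
# Crux `PercNonProliferation.SubpolynomialBlocking` (stmt-CriticalPhenomena-4446), line `cross-sandwich-flat-seal` — stub `stub_tiling`

Helper file for the lead's skeleton of line `cross-sandwich-flat-seal`
(prover-line-stmt-CriticalPhenomena-4446-0). Proves exactly the registered stub signature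
`stub_tiling`; lands with `--supports stmt-CriticalPhenomena-4446`.

Write `seal_i(Icc a b)` for "NO open path inside the coordinate box `Icc a b ⊆ ℤ³` from its face
`{x_i = a_i}` to its face `{x_i = b_i}`" (complement of `openCrossing`). Statement: for `k ≥ 1`
there are `K = (12k+1)²`, `N = 2k` with `P(seal₀([0,n]×[0,n+m]²))^K ≤ P(seal₀([n,2n]×[-2n,2n]²))`
for `n ≥ N`, `m = ⌊n/k⌋`, at `p_c(ℤ³)` (the helpers hold at every `p`).

Argument (Union-Lemma tiling): `StubTiling.union` — closed cutsets glue by union, with the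
crossing direction `i` and the gluing direction `j ≠ i` as parameters (an open crossing walk of
`Icc a b'` stays in `{x_j ≤ b_j}`, or in `{x_j ≥ a'_j}`, or traverses the overlap `Icc a' b` from
`{x_j = a'_j}` to `{x_j = b_j}`: `walk_band_trichotomy`; conjunct 4 of the barrier file
`TransverseCrossingsNeedNotMeetNarrow`, folklore); `seal_mono` — restriction to sub-boxes of full
extent; `real_seal_iso/shift/perm` — lattice symmetry (Grimmett 1999, §1.6); `tile` — glue `r`
translates at pitch `m` along `j`, Harris–FKG for decreasing events at each step (Grimmett 1999,
Thm. 2.4), `P ≥ s^(2r+1)`; `main` — seeds and `(0 1)`-, `(0 2)`-swapped seeds tile the strip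
`[n,2n]×[-2n,2n]×[-2n,-n+m]` (across `0`) and the overlap slab `[n,2n]×[-2n,2n]×[-2n+m,-n+m]`
(across `2`) along `x₁`, then `6k+1` strips tile the face-slab along `x₂`; restrict.
-/

noncomputable section

namespace Summit.CriticalPhenomena.PercolationContinuityZ3.Theorems.SubpolynomialBlocking

open MeasureTheory
open Literature.Probability.Percolation Literature.Probability.LatticeModels
open Literature.Barriers.CriticalPhenomena

namespace StubTiling

/-! ### Seal events of coordinate boxes: monotonicity, measurability, symmetry -/

/-- The seal event of `Icc a b` across `i` is decreasing. -/
theorem isLowerSet_seal (a b : Site 3) (i : Fin 3) :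
    IsLowerSet (openCrossing (Set.Icc a b) {x | x ∈ Set.Icc a b ∧ x i = a i}
      {y | y ∈ Set.Icc a b ∧ y i = b i})ᶜ :=
  (isUpperSet_openCrossing _ _ _).compl

/-- The seal event of `Icc a b` across `i` is measurable. -/
theorem measurableSet_seal (a b : Site 3) (i : Fin 3) :
    MeasurableSet (openCrossing (Set.Icc a b) {x | x ∈ Set.Icc a b ∧ x i = a i}
      {y | y ∈ Set.Icc a b ∧ y i = b i})ᶜ :=
  (measurableSet_openCrossing_of_countable _ _ _).compl

/-- **Restriction.** A seal of `Icc a b` across `i` is a seal of every sub-box `Icc a' b'` with the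
same extent in direction `i` (a crossing of the sub-box is a crossing of the box). -/
theorem seal_mono {i : Fin 3} {a b a' b' : Site 3} (ha : a ≤ a') (hb : b' ≤ b) (hai : a' i = a i)
    (hbi : b' i = b i) :
    (openCrossing (Set.Icc a b) {x | x ∈ Set.Icc a b ∧ x i = a i}
        {y | y ∈ Set.Icc a b ∧ y i = b i})ᶜ ⊆
      (openCrossing (Set.Icc a' b') {x | x ∈ Set.Icc a' b' ∧ x i = a' i}
        {y | y ∈ Set.Icc a' b' ∧ y i = b' i})ᶜ :=
  Set.compl_subset_compl.2 (openCrossing_mono (Set.Icc_subset_Icc ha hb)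
    (fun _ hx => ⟨Set.Icc_subset_Icc ha hb hx.1, hx.2.trans hai⟩)
    (fun _ hy => ⟨Set.Icc_subset_Icc ha hb hy.1, hy.2.trans hbi⟩))

/-- **Symmetry.** A lattice automorphism mapping the box `Icc a b` onto `Icc a' b'` and its two
`i`-faces onto the two `i'`-faces preserves the probability of the seal event (Grimmett 1999, §1.6). -/
theorem real_seal_iso (φ : zdGraph 3 ≃g zdGraph 3) (p : unitInterval) {a b a' b' : Site 3}
    {i i' : Fin 3} (hS : ∀ x, φ.toEquiv x ∈ Set.Icc a' b' ↔ x ∈ Set.Icc a b)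
    (hlo : ∀ x, φ.toEquiv x i' = a' i' ↔ x i = a i)
    (hhi : ∀ x, φ.toEquiv x i' = b' i' ↔ x i = b i) :
    (bondPercolation (zdGraph 3) p).real
        (openCrossing (Set.Icc a' b') {x | x ∈ Set.Icc a' b' ∧ x i' = a' i'}
          {y | y ∈ Set.Icc a' b' ∧ y i' = b' i'})ᶜ =
      (bondPercolation (zdGraph 3) p).real
        (openCrossing (Set.Icc a b) {x | x ∈ Set.Icc a b ∧ x i = a i}
          {y | y ∈ Set.Icc a b ∧ y i = b i})ᶜ := by
  have key : ∀ {S T : Set (Site 3)}, (∀ x, φ.toEquiv x ∈ T ↔ x ∈ S) → φ.toEquiv '' S = T :=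
    fun h => Set.ext fun y => by rw [Set.mem_image_equiv, ← h, Equiv.apply_symm_apply]
  have h1 : φ.toEquiv '' Set.Icc a b = Set.Icc a' b' := key hS
  have h2 : φ.toEquiv '' {x | x ∈ Set.Icc a b ∧ x i = a i} =
      {x | x ∈ Set.Icc a' b' ∧ x i' = a' i'} := key fun x => and_congr (hS x) (hlo x)
  have h3 : φ.toEquiv '' {y | y ∈ Set.Icc a b ∧ y i = b i} =
      {y | y ∈ Set.Icc a' b' ∧ y i' = b' i'} := key fun x => and_congr (hS x) (hhi x)
  refine (bondPercolation_real_preimage_relabel_iso φ p _).symm.trans ?_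
  rw [← h2, ← h3, ← h1, Set.preimage_compl, preimage_relabel_openCrossing]

/-- Translation invariance of seal probabilities. -/
theorem real_seal_shift (p : unitInterval) (v a b : Site 3) (i : Fin 3) :
    (bondPercolation (zdGraph 3) p).real
        (openCrossing (Set.Icc (a + v) (b + v)) {x | x ∈ Set.Icc (a + v) (b + v) ∧ x i = (a + v) i}
          {y | y ∈ Set.Icc (a + v) (b + v) ∧ y i = (b + v) i})ᶜ =
      (bondPercolation (zdGraph 3) p).real
        (openCrossing (Set.Icc a b) {x | x ∈ Set.Icc a b ∧ x i = a i}
          {y | y ∈ Set.Icc a b ∧ y i = b i})ᶜ :=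
  real_seal_iso (zdShiftIso v) p
    (fun x => by
      show x + v ∈ Set.Icc (a + v) (b + v) ↔ x ∈ Set.Icc a b
      simp only [Set.mem_Icc, add_le_add_iff_right])
    (fun x => by show (x + v) i = (a + v) i ↔ x i = a i; simp)
    (fun x => by show (x + v) i = (b + v) i ↔ x i = b i; simp)

/-- Invariance of seal probabilities under coordinate permutations (the box `Icc a b` sealed
across `i` goes to `Icc (σ a) (σ b)` sealed across `π i`, `σ x = x ∘ π⁻¹`). -/
theorem real_seal_perm (p : unitInterval) (π : Equiv.Perm (Fin 3)) (a b : Site 3) (i : Fin 3) :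
    (bondPercolation (zdGraph 3) p).real
        (openCrossing (Set.Icc (Site.signedPerm π 1 a) (Site.signedPerm π 1 b))
          {x | x ∈ Set.Icc (Site.signedPerm π 1 a) (Site.signedPerm π 1 b) ∧
            x (π i) = Site.signedPerm π 1 a (π i)}
          {y | y ∈ Set.Icc (Site.signedPerm π 1 a) (Site.signedPerm π 1 b) ∧
            y (π i) = Site.signedPerm π 1 b (π i)})ᶜ =
      (bondPercolation (zdGraph 3) p).real
        (openCrossing (Set.Icc a b) {x | x ∈ Set.Icc a b ∧ x i = a i}
          {y | y ∈ Set.Icc a b ∧ y i = b i})ᶜ :=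
  real_seal_iso (zdSignedPermIso π 1) p
    (fun x => by
      show Site.signedPerm π 1 x ∈ _ ↔ _
      simp only [Set.mem_Icc, Pi.le_def, Site.signedPerm_apply, Pi.one_apply, Units.val_one,
        one_mul]
      exact and_congr (π.symm.surjective.forall (p := fun l => a l ≤ x l)).symm
        (π.symm.surjective.forall (p := fun l => x l ≤ b l)).symm)
    (fun x => by show Site.signedPerm π 1 x (π i) = Site.signedPerm π 1 a (π i) ↔ _; simp)
    (fun x => by show Site.signedPerm π 1 x (π i) = Site.signedPerm π 1 b (π i) ↔ _; simp)

/-- Coordinate permutation followed by a translation. -/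
theorem real_seal_perm_shift (p : unitInterval) (π : Equiv.Perm (Fin 3)) (v a b : Site 3)
    (i : Fin 3) :
    (bondPercolation (zdGraph 3) p).real
        (openCrossing (Set.Icc (Site.signedPerm π 1 a + v) (Site.signedPerm π 1 b + v))
          {x | x ∈ Set.Icc (Site.signedPerm π 1 a + v) (Site.signedPerm π 1 b + v) ∧
            x (π i) = (Site.signedPerm π 1 a + v) (π i)}
          {y | y ∈ Set.Icc (Site.signedPerm π 1 a + v) (Site.signedPerm π 1 b + v) ∧
            y (π i) = (Site.signedPerm π 1 b + v) (π i)})ᶜ =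
      (bondPercolation (zdGraph 3) p).real
        (openCrossing (Set.Icc a b) {x | x ∈ Set.Icc a b ∧ x i = a i}
          {y | y ∈ Set.Icc a b ∧ y i = b i})ᶜ := by
  rw [real_seal_shift, real_seal_perm]

/-! ### The Union Lemma with direction parameters -/

/-- **UNION LEMMA** (closed cutsets glue by union; `cutsets_glue` of the barrier file with the
crossing direction `i` and the gluing direction `j ≠ i` as parameters). For a lattice
configuration `ω`: if `Icc a b` and `Icc a' b'` are sealed across `i`, where `a, a'` and `b, b'`
agree off `j` and `a'_j ≤ b_j`, and the overlap `Icc a' b` is sealed across `j`, then `Icc a b'`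
is sealed across `i`. An open crossing walk of `Icc a b'` stays in `{x_j ≤ b_j}` (a crossing of
`Icc a b`), or in `{x_j ≥ a'_j}` (a crossing of `Icc a' b'`), or traverses the overlap from
`{x_j = a'_j}` to `{x_j = b_j}` (`walk_band_trichotomy`). -/
theorem union {i j : Fin 3} (hij : i ≠ j) {a b a' b' : Site 3} (ha' : ∀ l, l ≠ j → a' l = a l)
    (hb' : ∀ l, l ≠ j → b' l = b l) (h2 : a' j ≤ b j) {ω : BondConfig (Site 3)}
    (hω : ω ⊆ (zdGraph 3).edgeSet)
    (hA : ω ∈ (openCrossing (Set.Icc a b) {x | x ∈ Set.Icc a b ∧ x i = a i}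
      {y | y ∈ Set.Icc a b ∧ y i = b i})ᶜ)
    (hB : ω ∈ (openCrossing (Set.Icc a' b') {x | x ∈ Set.Icc a' b' ∧ x i = a' i}
      {y | y ∈ Set.Icc a' b' ∧ y i = b' i})ᶜ)
    (hO : ω ∈ (openCrossing (Set.Icc a' b) {x | x ∈ Set.Icc a' b ∧ x j = a' j}
      {y | y ∈ Set.Icc a' b ∧ y j = b j})ᶜ) :
    ω ∈ (openCrossing (Set.Icc a b') {x | x ∈ Set.Icc a b' ∧ x i = a i}
      {y | y ∈ Set.Icc a b' ∧ y i = b' i})ᶜ := by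
  rintro ⟨x, ⟨hx, hxi⟩, y, ⟨hy, hyi⟩, hxy⟩
  obtain ⟨P, hPS, hPω⟩ := exists_walk_of_mem_openConnIn hω hxy
  rcases walk_band_trichotomy (fun z : Site 3 => z j) (apply_le_apply_add_one_of_adj j) P h2 with
    hl | hr | ⟨c, e, W, hc, he, hW, hWe⟩
  · have hin : ∀ z ∈ P.support, z ∈ Set.Icc a b := fun z hz =>
      ⟨(hPS z hz).1, fun l => by
        rcases eq_or_ne l j with rfl | hl'
        · exact hl z hz
        · rw [← hb' l hl']; exact (hPS z hz).2 l⟩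
    exact hA ⟨x, ⟨hin x P.start_mem_support, hxi⟩, y,
      ⟨hin y P.end_mem_support, by rw [← hb' i hij]; exact hyi⟩, mem_openConnIn_of_walk P hin hPω⟩
  · have hin : ∀ z ∈ P.support, z ∈ Set.Icc a' b' := fun z hz =>
      ⟨fun l => by
        rcases eq_or_ne l j with rfl | hl'
        · exact hr z hz
        · rw [ha' l hl']; exact (hPS z hz).1 l, (hPS z hz).2⟩
    exact hB ⟨x, ⟨hin x P.start_mem_support, by rw [ha' i hij]; exact hxi⟩, y,
      ⟨hin y P.end_mem_support, hyi⟩, mem_openConnIn_of_walk P hin hPω⟩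
  · have hin : ∀ z ∈ W.support, z ∈ Set.Icc a' b := fun z hz =>
      ⟨fun l => by
        rcases eq_or_ne l j with rfl | hl'
        · exact (hW z hz).2.1
        · rw [ha' l hl']; exact (hPS z (hW z hz).1).1 l,
       fun l => by
        rcases eq_or_ne l j with rfl | hl'
        · exact (hW z hz).2.2
        · rw [← hb' l hl']; exact (hPS z (hW z hz).1).2 l⟩
    exact hO ⟨c, ⟨hin c W.start_mem_support, hc⟩, e, ⟨hin e W.end_mem_support, he⟩,
      mem_openConnIn_of_walk W hin fun q hq => hPω q (hWe q hq)⟩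

/-! ### Tiling: translates glued along `j`, Harris–FKG at each step -/

/-- **Strip tiling.** If the box `Icc a b` sealed across `i` has probability `≥ s` and the
overlap-shaped box `Icc (a + m e_j) b` sealed across `j ≠ i` has probability `≥ s`
(`a_j + m ≤ b_j`), then the box stretched by `r m` in direction `j` is sealed across `i` with
probability `≥ s^(2r+1)`: induction on `r`, gluing one more translate (`union`, translation
invariance) with Harris–FKG for the three decreasing events (Grimmett 1999, Thm. 2.4). -/
theorem tile (p : unitInterval) {i j : Fin 3} (hij : i ≠ j) (a b : Site 3) {m : ℤ}
    (hm : a j + m ≤ b j) {s : ℝ} (hs : 0 ≤ s)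
    (hA : s ≤ (bondPercolation (zdGraph 3) p).real
      (openCrossing (Set.Icc a b) {x | x ∈ Set.Icc a b ∧ x i = a i}
        {y | y ∈ Set.Icc a b ∧ y i = b i})ᶜ)
    (hO : s ≤ (bondPercolation (zdGraph 3) p).real
      (openCrossing (Set.Icc (a + Pi.single j m) b)
        {x | x ∈ Set.Icc (a + Pi.single j m) b ∧ x j = (a + Pi.single j m : Site 3) j}
        {y | y ∈ Set.Icc (a + Pi.single j m) b ∧ y j = b j})ᶜ) (r : ℕ) :
    s ^ (2 * r + 1) ≤ (bondPercolation (zdGraph 3) p).real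
      (openCrossing (Set.Icc a (b + Pi.single j (r * m)))
        {x | x ∈ Set.Icc a (b + Pi.single j (r * m)) ∧ x i = a i}
        {y | y ∈ Set.Icc a (b + Pi.single j (r * m)) ∧
          y i = (b + Pi.single j (r * m) : Site 3) i})ᶜ := by
  induction r with
  | zero => simpa using hA
  | succ r ih =>
    have e1 : a + Pi.single j (((r + 1 : ℕ) : ℤ) * m) =
        a + Pi.single j m + Pi.single j ((r : ℤ) * m) := by
      rw [add_assoc, ← Pi.single_add]; congr 2; push_cast; ring
    have hB' := hA
    rw [← real_seal_shift p (Pi.single j (((r + 1 : ℕ) : ℤ) * m))] at hB'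
    have hO' := hO
    rw [← real_seal_shift p (Pi.single j ((r : ℤ) * m)), ← e1] at hO'
    calc s ^ (2 * (r + 1) + 1) = s ^ (2 * r + 1) * s * s := by ring
      _ ≤ _ := mul_le_mul (mul_le_mul ih hB' hs measureReal_nonneg) hO' hs
          (mul_nonneg measureReal_nonneg measureReal_nonneg)
      _ ≤ _ := mul_le_mul_of_nonneg_right (harris_fkg_lower _ p (isLowerSet_seal _ _ _)
          (isLowerSet_seal _ _ _) (measurableSet_seal _ _ _) (measurableSet_seal _ _ _))
          measureReal_nonneg
      _ ≤ _ := harris_fkg_lower _ p ((isLowerSet_seal _ _ _).inter (isLowerSet_seal _ _ _))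
          (isLowerSet_seal _ _ _) ((measurableSet_seal _ _ _).inter (measurableSet_seal _ _ _))
          (measurableSet_seal _ _ _)
      _ ≤ _ := DCT16.real_mono_of_forall_subset_edgeSet _ p fun ω hω h =>
          union hij (fun l hl => by simp [hl]) (fun l hl => by simp [hl]) (by simp; linarith) hω
            h.1.1 h.1.2 h.2

/-! ### The tiling of the face-slab by seeds -/

/-- **Seeds tile the face-slab.** For integers `n, m ≥ 0` with `3n ≤ 6km`:
`P(seal₀([0,n]×[0,n+m]²))^((12k+1)²) ≤ P(seal₀([n,2n]×[-2n,2n]²))`. The three symmetric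
copies of the seed (`real_seal_shift`, `real_seal_perm_shift` with the transpositions `(0 1)`,
`(0 2)`), restricted to the overlap boxes (`seal_mono`), feed `tile` three times: along `x₁`
for the strip `[n,2n]×[-2n,2n]×[-2n,-n+m]` sealed across `0`, along `x₁` for the overlap slab
`[n,2n]×[-2n,2n]×[-2n+m,-n+m]` sealed across `2`, and along `x₂` for the face-slab. -/
theorem main (p : unitInterval) (k : ℕ) (n m : ℤ) (hn : 0 ≤ n) (hm : 0 ≤ m)
    (h3 : 3 * n ≤ 6 * k * m) :
    (bondPercolation (zdGraph 3) p).real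
        (openCrossing (Set.Icc (0 : Site 3) ![n, n + m, n + m])
          {x | x ∈ Set.Icc (0 : Site 3) ![n, n + m, n + m] ∧ x 0 = 0}
          {y | y ∈ Set.Icc (0 : Site 3) ![n, n + m, n + m] ∧ y 0 = n})ᶜ ^
        ((2 * (6 * k) + 1) * (2 * (6 * k) + 1)) ≤
      (bondPercolation (zdGraph 3) p).real
        (openCrossing (Set.Icc (![n, -(2 * n), -(2 * n)] : Site 3) ![2 * n, 2 * n, 2 * n])
          {x | x ∈ Set.Icc (![n, -(2 * n), -(2 * n)] : Site 3) ![2 * n, 2 * n, 2 * n] ∧ x 0 = n}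
          {y | y ∈ Set.Icc (![n, -(2 * n), -(2 * n)] : Site 3) ![2 * n, 2 * n, 2 * n] ∧
            y 0 = 2 * n})ᶜ := by
  set s := (bondPercolation (zdGraph 3) p).real
        (openCrossing (Set.Icc (0 : Site 3) ![n, n + m, n + m])
          {x | x ∈ Set.Icc (0 : Site 3) ![n, n + m, n + m] ∧ x 0 = 0}
          {y | y ∈ Set.Icc (0 : Site 3) ![n, n + m, n + m] ∧ y 0 = n})ᶜ
  have hs0 : 0 ≤ s := measureReal_nonneg
  -- the seed translated to `[n,2n] × [-2n,-n+m]²` (across `0`); the `(0 1)`-swapped seed at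
  -- `[n,2n+m] × [-2n+m,-n+m] × [-2n,-n+m]` (across `1`); the `(0 2)`-swapped seed at
  -- `[n,2n+m] × [-2n,-n+m] × [-2n+m,-n+m]` (across `2`): all of probability `s`
  have q1 := real_seal_shift p ![n, -(2 * n), -(2 * n)] 0 ![n, n + m, n + m] 0
  rw [zero_add, show (![n, n + m, n + m] : Site 3) + ![n, -(2 * n), -(2 * n)] =
    ![2 * n, -n + m, -n + m] from funext fun l => by fin_cases l <;> simp <;> ring] at q1
  have q2 := real_seal_perm_shift p (Equiv.swap 0 1) ![n, -(2 * n) + m, -(2 * n)] 0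
    ![n, n + m, n + m] 0
  rw [Site.signedPerm_zero, zero_add,
    show Site.signedPerm (Equiv.swap (0 : Fin 3) 1) 1 (![n, n + m, n + m] : Site 3) +
        ![n, -(2 * n) + m, -(2 * n)] = ![2 * n + m, -n + m, -n + m] from
      funext fun l => by fin_cases l <;> simp [Equiv.swap_apply_of_ne_of_ne] <;> ring,
    show Equiv.swap (0 : Fin 3) 1 0 = 1 from Equiv.swap_apply_left 0 1] at q2
  have q3 := real_seal_perm_shift p (Equiv.swap 0 2) ![n, -(2 * n), -(2 * n) + m] 0
    ![n, n + m, n + m] 0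
  rw [Site.signedPerm_zero, zero_add,
    show Site.signedPerm (Equiv.swap (0 : Fin 3) 2) 1 (![n, n + m, n + m] : Site 3) +
        ![n, -(2 * n), -(2 * n) + m] = ![2 * n + m, -n + m, -n + m] from
      funext fun l => by fin_cases l <;> simp [Equiv.swap_apply_of_ne_of_ne] <;> ring,
    show Equiv.swap (0 : Fin 3) 2 0 = 2 from Equiv.swap_apply_left 0 2] at q3
  -- coordinates of the translated corners
  have v1 : (![n, -(2 * n), -(2 * n)] : Site 3) + Pi.single 1 m = ![n, -(2 * n) + m, -(2 * n)] := by
    ext l; fin_cases l <;> simp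
  have v2 : (![n, -(2 * n), -(2 * n)] : Site 3) + Pi.single 2 m = ![n, -(2 * n), -(2 * n) + m] := by
    ext l; fin_cases l <;> simp
  have v21 : (![n, -(2 * n), -(2 * n) + m] : Site 3) + Pi.single 1 m =
      ![n, -(2 * n) + m, -(2 * n) + m] := by
    ext l; fin_cases l <;> simp
  have w1 : (![2 * n, -n + m, -n + m] : Site 3) + Pi.single 1 (((6 * k : ℕ) : ℤ) * m) =
      ![2 * n, -n + m + 6 * k * m, -n + m] := by
    ext l; fin_cases l <;> simp
  have w2 : (![2 * n, 2 * n, -n + m] : Site 3) + Pi.single 2 (((6 * k : ℕ) : ℤ) * m) =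
      ![2 * n, 2 * n, -n + m + 6 * k * m] := by
    ext l; fin_cases l <;> simp
  -- strip `[n,2n] × [-2n,2n] × [-2n,-n+m]` sealed across `0`: tile along `x₁`, then restrict
  have hT1 := tile p (i := 0) (j := 1) (by decide) ![n, -(2 * n), -(2 * n)]
    ![2 * n, -n + m, -n + m] (m := m) (by simp; linarith) hs0 q1.symm.le
    (by
      rw [v1]
      exact q2.symm.le.trans (measureReal_mono (seal_mono le_rfl
        (fun l => by
          fin_cases l <;> simp
          all_goals linarith) rfl rfl))) (6 * k)
  rw [w1] at hT1
  have hS := hT1.trans (measureReal_mono (seal_mono (a' := ![n, -(2 * n), -(2 * n)])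
    (b' := ![2 * n, 2 * n, -n + m]) le_rfl
    (fun l => by
      fin_cases l <;> simp
      all_goals linarith) rfl rfl))
  -- overlap slab `[n,2n] × [-2n,2n] × [-2n+m,-n+m]` sealed across `2`: tile along `x₁`, restrict
  have hT2 := tile p (i := 2) (j := 1) (by decide) ![n, -(2 * n), -(2 * n) + m]
    ![2 * n, -n + m, -n + m] (m := m) (by simp; linarith) hs0
    (q3.symm.le.trans (measureReal_mono (seal_mono le_rfl
      (fun l => by
        fin_cases l <;> simp
        all_goals linarith) rfl rfl)))
    (by
      rw [v21]
      exact q2.symm.le.trans (measureReal_mono (seal_mono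
        (fun l => by
          fin_cases l <;> simp
          all_goals linarith)
        (fun l => by
          fin_cases l <;> simp
          all_goals linarith) rfl rfl))) (6 * k)
  rw [w1] at hT2
  have hU := hT2.trans (measureReal_mono (seal_mono (a' := ![n, -(2 * n), -(2 * n) + m])
    (b' := ![2 * n, 2 * n, -n + m]) le_rfl
    (fun l => by
      fin_cases l <;> simp
      all_goals linarith) rfl rfl))
  -- the face-slab: tile the strips along `x₂` through the overlap slabs, then restrict
  have hT3 := tile p (i := 0) (j := 2) (by decide) ![n, -(2 * n), -(2 * n)]
    ![2 * n, 2 * n, -n + m] (m := m) (by simp; linarith) (pow_nonneg hs0 _) hS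
    (by rw [v2]; exact hU) (6 * k)
  rw [w2] at hT3
  rw [pow_mul]
  exact hT3.trans (measureReal_mono (seal_mono le_rfl
    (fun l => by
      fin_cases l <;> simp
      all_goals linarith) rfl rfl))

end StubTiling

/-- **Registered stub `stub_tiling`** of line `cross-sandwich-flat-seal` (crux
`SubpolynomialBlocking`, stmt-CriticalPhenomena-4446): for every `k ≥ 1` there are `K, N`
(`K = (12k+1)²`, `N = 2k`) such that for `n ≥ N` the flat seed `[0,n] × [0, n + ⌊n/k⌋]²` sealed
across its thin direction controls the face-slab `[n,2n] × [-2n,2n]²` sealed across its thin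
direction: `P_{p_c}(seal seed)^K ≤ P_{p_c}(seal slab)` (Union-Lemma tiling + Harris–FKG,
`StubTiling.main`). -/
theorem stub_tiling :
    ∀ k : ℕ, 1 ≤ k → ∃ K N : ℕ, ∀ n : ℕ, N ≤ n →
      (bondPercolation (zdGraph 3) (criticalProbI 3)).real
          (openCrossing (Set.Icc (0 : Site 3) ![(n : ℤ), (n : ℤ) + (n / k : ℕ), (n : ℤ) + (n / k : ℕ)])
            {x | x ∈ Set.Icc (0 : Site 3) ![(n : ℤ), (n : ℤ) + (n / k : ℕ), (n : ℤ) + (n / k : ℕ)] ∧ x 0 = 0}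
            {y | y ∈ Set.Icc (0 : Site 3) ![(n : ℤ), (n : ℤ) + (n / k : ℕ), (n : ℤ) + (n / k : ℕ)] ∧
              y 0 = (n : ℤ)})ᶜ ^ K ≤
        (bondPercolation (zdGraph 3) (criticalProbI 3)).real
          (openCrossing (Set.Icc (![(n : ℤ), -(2 * (n : ℤ)), -(2 * (n : ℤ))] : Site 3)
              ![2 * (n : ℤ), 2 * (n : ℤ), 2 * (n : ℤ)])
            {x | x ∈ Set.Icc (![(n : ℤ), -(2 * (n : ℤ)), -(2 * (n : ℤ))] : Site 3)
              ![2 * (n : ℤ), 2 * (n : ℤ), 2 * (n : ℤ)] ∧ x 0 = (n : ℤ)}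
            {y | y ∈ Set.Icc (![(n : ℤ), -(2 * (n : ℤ)), -(2 * (n : ℤ))] : Site 3)
              ![2 * (n : ℤ), 2 * (n : ℤ), 2 * (n : ℤ)] ∧ y 0 = 2 * (n : ℤ)})ᶜ := by
  intro k hk
  refine ⟨(2 * (6 * k) + 1) * (2 * (6 * k) + 1), 2 * k, fun n hn => ?_⟩
  have h1 := Nat.div_add_mod n k
  have h2 := Nat.mod_lt n (show 0 < k by omega)
  generalize n / k = q at h1 ⊢
  generalize n % k = ρ at h1 h2
  have h3 : 3 * (n : ℤ) ≤ 6 * k * (q : ℤ) := by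
    zify at h1 h2 hn
    nlinarith
  exact StubTiling.main (criticalProbI 3) k n q (Nat.cast_nonneg n) (Nat.cast_nonneg q) h3

end Summit.CriticalPhenomena.PercolationContinuityZ3.Theorems.SubpolynomialBlocking

end
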